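/-
Origin: expansion seat `planner-pub-hodgecm-prl1-g4-0`, handover #4 2026-08-18T07:30:12Z (`HOME/pub-hodgecm-prl1-g4/lean/Prl1g4/LatticeModelThetaData.lean`, md5 91522e2c, 286 lines);
landed by the gen-7 packager in gate run 26 as `HodgeCM/Automorphic/LatticeModelThetaData.lean` (import ^import Prl1g4\.→import HodgeCM.Automorphic. ×1).
-/
/-
Origin: HOME/pub-hodgecm-prl1-g4/lean/Prl1g4/LatticeModelThetaData.lean — session planner-pub-hodgecm-prl1-g4-0
(unit pub-hodgecm-prl1-g4, EXPANSION PROVER a-1 gen 4, STRATEGY 1 CONSTRUCT; lineage prl1).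
Intended final place (packager's call): `HodgeCM/Automorphic/LatticeModelThetaData.lean`.
NEW, ADDITIVE LEAF; WIP imports ↦ landed names: `Prl1g4.WeilModelThetaData` ↦ `HodgeCM.Automorphic.WeilModelThetaData`
(my HANDOVER #2, 3876fdf5bad1, run 25), `Prl1g4.QuotientModelOfLattice` ↦ `HodgeCM.Automorphic.QuotientModelOfLattice`
(my HANDOVER #3, 51218abae8a8, run 26).  Lands AFTER both.  My `lean/{Pv15g2,Prl1g3,Pv06g3,Pv09g4}/` copies are byte
MIRRORS for local elaboration — DO NOT LAND.
KIND: KERNEL + END STATE — nothing cited, nothing posited.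
-/
import Summits.HodgeConjecture.HodgeCM.Automorphic.WeilModelThetaData
import Summits.HodgeConjecture.HodgeCM.Automorphic.QuotientModelOfLattice

/-!
# The theta carrier over LATTICE models: no measure-theoretic datum and no `hfc` left

My END STATE over Weil theta models (`Assembly.realisationExists_ofWeilModelData`, HANDOVER #2) takes as DATA, per
`(L, ι₁, V)` and per seesaw context, a compact Haar quotient MODEL (`QuotientModel`: a locally compact group, a
discrete countable closed cocompact subgroup, a Haar measure that is regular AND RIGHT-INVARIANT, a measurable
fundamental domain of finite measure) and the hypothesis `hfc` (first countability of `U(W)(𝔸)`, for the Dirac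
sequences of [SETUP D7]).  `QuotientModel.ofLattice` (HANDOVER #3) CONSTRUCTS such a model from a cocompact lattice
in a locally compact second countable Hausdorff group ALONE (unimodularity is a theorem there; the fundamental
domain is pv09-g4's), and such models are first countable.

This file is the junction:

* §1 `CocompactLatticeModel` — the DATA `(G, Γ)`: a locally compact, Hausdorff, second countable topological group
  and a subgroup with `DiscreteTopology Γ` and `CompactSpace (G ⧸ Γ)`; `toQuotientModel := QuotientModel.ofLattice`.
* §2 `Universe.LatticeModelThetaData U` — `WeilModelThetaData` with the two `QuotientModel`-valued fields `quotU`,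
  `quot` REPLACED by `CocompactLatticeModel`-valued ones (every dependent field typed through `toQuotientModel`);
  `toWeilModelThetaData`; `firstCountable` (the former hypothesis `hfc`, now an instance).
* §3 END STATE **`Assembly.realisationExists_ofLatticeModelData`** (`U.RealisationExistsPerL ∧
  U.RealisationExistsFace`), **`perL_ofLatticeModelData`**, **`COR_CM_endState_ofLatticeModelData`**: the
  statements of HANDOVER #2 with `hfc` DISCHARGED and the models' measure theory CONSTRUCTED.

NET HYPOTHESES of the END STATE: `M : U.ModelAxioms` · the DATA `D : U.LatticeModelThetaData` (per `(L, ι₁, V)` the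
topological group `G_U(𝔸)` with its discrete cocompact `G_U(L⁺)`, per context `U(W)(𝔸) ⊇ U(W)(L₀)` likewise —
[SETUP] discreteness of rational points and compactness of the quotients (anisotropy, PerL v5 l. 385) —, the Weil
theta model of the context with its labelled print / class-U / DEF fields, tori, `emb`, `cover`, sign recipe, theta
one-forms) · per context and torus side pv06-g3's `QuotientTorusDatum` · the ten theta `Inputs` ·
`hHR : U.Fact_hodgeRiemann20` (+ for COR-CM: `h29`, `h30`, the three QW8 facts).  DIVERGENCE (recorded, unchanged):
no adelic unitary group is constructed — `G_U(𝔸)`, `U(W)(𝔸)` are data.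
-/

set_option autoImplicit false

noncomputable section

open MeasureTheory Set Filter Function Topology

attribute [-instance] Quotient.instMeasurableSpace

namespace HodgeCM

/-! ## 1. Cocompact lattice models -/

/-- **A cocompact lattice model**: a locally compact, Hausdorff, second countable topological group `G` and a
subgroup `Γ` that is discrete with `G ⧸ Γ` compact.  Dictionary: `(U(W)(𝔸), U(W)(L₀))`, `(G_U(𝔸), G_U(L⁺))`. -/
structure CocompactLatticeModel where
  /-- the ambient group (`U(W)(𝔸)`, `G_U(𝔸)`) -/
  G : Type
  [grp : Group G]
  [top : TopologicalSpace G]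
  [topGrp : IsTopologicalGroup G]
  [locCpt : LocallyCompactSpace G]
  [t2 : T2Space G]
  [secondCountable : SecondCountableTopology G]
  /-- the lattice (`U(W)(L₀)`, `G_U(L⁺)`) -/
  Γ : Subgroup G
  /-- [SETUP] rational points are discrete -/
  [disc : DiscreteTopology Γ]
  /-- [SETUP] the quotient is compact (anisotropy) -/
  [cocompact : CompactSpace (G ⧸ Γ)]

attribute [instance] CocompactLatticeModel.grp CocompactLatticeModel.top CocompactLatticeModel.topGrp
  CocompactLatticeModel.locCpt CocompactLatticeModel.t2 CocompactLatticeModel.secondCountable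
  CocompactLatticeModel.disc CocompactLatticeModel.cocompact

namespace CocompactLatticeModel

variable (M : CocompactLatticeModel)

/-- The compact Haar quotient model of a cocompact lattice model: `QuotientModel.ofLattice` (Borel σ-algebra,
`μ := haar` — right invariant by the unimodularity theorem —, pv09-g4's fundamental domain). -/
def toQuotientModel : QuotientModel := QuotientModel.ofLattice M.G M.Γ

/-- (Ported verbatim from the HodgeCMPerL package; no docstring in the source.) -/
@[simp] theorem toQuotientModel_G : M.toQuotientModel.G = M.G := rfl

/-- (Ported verbatim from the HodgeCMPerL package; no docstring in the source.) -/
@[simp] theorem toQuotientModel_Γ : M.toQuotientModel.Γ = M.Γ := rfl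

/-- The former END-STATE hypothesis `hfc`: the model group is first countable. -/
instance firstCountableTopology_toQuotientModel : FirstCountableTopology M.toQuotientModel.G :=
  QuotientModel.firstCountableTopology_ofLattice M.G M.Γ

/-- (Ported verbatim from the HodgeCMPerL package; no docstring in the source.) -/
instance secondCountableTopology_toQuotientModel : SecondCountableTopology M.toQuotientModel.G :=
  M.secondCountable

end CocompactLatticeModel

namespace Universe

open HodgeCM.PerL34 HodgeCM.PerL34.Annihilation
open HodgeCM.Prior.Perl34File HodgeCM.Prior.Perl34File.Perl34

variable (U : Universe)

/-! ## 2. Theta data over lattice models -/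

/-- **Theta data over LATTICE models with the theta side a `WeilThetaModel`**: `WeilModelThetaData` with the two
compact Haar quotient models per context replaced by cocompact lattice models `(G, Γ)`. -/
structure LatticeModelThetaData where
  /-- `(G_U(𝔸), G_U(L⁺))` -/
  latU : ∀ (L : CMField) (ι₁ : L →+* ℂ), HermSpace3 L ι₁ → CocompactLatticeModel
  /-- degree-two classes of `P_Γ` as `L²` functions on `[G_U]` -/
  emb : ∀ {L : CMField} {ι₁ : L →+* ℂ} {V : HermSpace3 L ι₁} (Γ : Level V),
    U.CohC (U.pms L ι₁ V Γ) 2 →ₗ[ℂ] (latU L ι₁ V).toQuotientModel.H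
  /-- the covering `P_{Γ'} → P_Γ` for `Γ' ≤ Γ` -/
  cover : ∀ {L : CMField} {ι₁ : L →+* ℂ} {V : HermSpace3 L ι₁} (Γ Γ' : Level V),
    Γ'.Γ ≤ Γ.Γ → U.Mor (U.pms L ι₁ V Γ') (U.pms L ι₁ V Γ)
  /-- sign recipe, first half -/
  kappa : ∀ (K L : CMField), (K →+* L) → (L →+* ℂ) → (L →+* ℂ) → (K →+* ℂ)
  /-- sign recipe, second half -/
  frameSign : ∀ (L : CMField), (L →+* ℂ) → (L →+* ℂ) → Bool
  /-- `(U(W)(𝔸), U(W)(L₀))` -/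
  lat : ∀ {L : CMField} {ι₁ : L →+* ℂ}, HermSpace3 L ι₁ → SeesawCtx L → CocompactLatticeModel
  /-- the Weil theta model of the context -/
  wm : ∀ {L : CMField} {ι₁ : L →+* ℂ} (V : HermSpace3 L ι₁) (c : SeesawCtx L),
    WeilThetaModel (latU L ι₁ V).toQuotientModel.G (latU L ι₁ V).toQuotientModel.Γ
      (lat V c).toQuotientModel.G (lat V c).toQuotientModel.Γ
  /-- `T₁₂(𝔸)` -/
  T12 : ∀ {L : CMField} {ι₁ : L →+* ℂ}, HermSpace3 L ι₁ → SeesawCtx L → Type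
  /-- `T₃₄(𝔸)` -/
  T34 : ∀ {L : CMField} {ι₁ : L →+* ℂ}, HermSpace3 L ι₁ → SeesawCtx L → Type
  [instT12₁ : ∀ {L : CMField} {ι₁ : L →+* ℂ} (V : HermSpace3 L ι₁) (c : SeesawCtx L), Group (T12 V c)]
  [instT12₂ : ∀ {L : CMField} {ι₁ : L →+* ℂ} (V : HermSpace3 L ι₁) (c : SeesawCtx L), TopologicalSpace (T12 V c)]
  [instT12₃ : ∀ {L : CMField} {ι₁ : L →+* ℂ} (V : HermSpace3 L ι₁) (c : SeesawCtx L), T2Space (T12 V c)]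
  [instT12₄ : ∀ {L : CMField} {ι₁ : L →+* ℂ} (V : HermSpace3 L ι₁) (c : SeesawCtx L), MeasurableSpace (T12 V c)]
  [instT12₅ : ∀ {L : CMField} {ι₁ : L →+* ℂ} (V : HermSpace3 L ι₁) (c : SeesawCtx L),
    OpensMeasurableSpace (T12 V c)]
  [instT34₁ : ∀ {L : CMField} {ι₁ : L →+* ℂ} (V : HermSpace3 L ι₁) (c : SeesawCtx L), Group (T34 V c)]
  [instT34₂ : ∀ {L : CMField} {ι₁ : L →+* ℂ} (V : HermSpace3 L ι₁) (c : SeesawCtx L), TopologicalSpace (T34 V c)]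
  [instT34₃ : ∀ {L : CMField} {ι₁ : L →+* ℂ} (V : HermSpace3 L ι₁) (c : SeesawCtx L), T2Space (T34 V c)]
  [instT34₄ : ∀ {L : CMField} {ι₁ : L →+* ℂ} (V : HermSpace3 L ι₁) (c : SeesawCtx L), MeasurableSpace (T34 V c)]
  [instT34₅ : ∀ {L : CMField} {ι₁ : L →+* ℂ} (V : HermSpace3 L ι₁) (c : SeesawCtx L),
    OpensMeasurableSpace (T34 V c)]
  /-- the (12) torus side over the kernel-model core of the Weil theta model -/
  kt12 : ∀ {L : CMField} {ι₁ : L →+* ℂ} (V : HermSpace3 L ι₁) (c : SeesawCtx L),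
    KernelTorusCarrier
      (KernelModel.core (latU L ι₁ V).toQuotientModel (lat V c).toQuotientModel (wm V c).SK (wm V c).omg
        (wm V c).θ) (T12 V c)
  /-- the (34) torus side over the kernel-model core of the Weil theta model -/
  kt34 : ∀ {L : CMField} {ι₁ : L →+* ℂ} (V : HermSpace3 L ι₁) (c : SeesawCtx L),
    KernelTorusCarrier
      (KernelModel.core (latU L ι₁ V).toQuotientModel (lat V c).toQuotientModel (wm V c).SK (wm V c).omg
        (wm V c).θ) (T34 V c)
  [instν12 : ∀ {L : CMField} {ι₁ : L →+* ℂ} (V : HermSpace3 L ι₁) (c : SeesawCtx L),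
    IsFiniteMeasureOnCompacts (kt12 V c).ν]
  [instν34 : ∀ {L : CMField} {ι₁ : L →+* ℂ} (V : HermSpace3 L ι₁) (c : SeesawCtx L),
    IsFiniteMeasureOnCompacts (kt34 V c).ν]
  /-- the theta one-forms of type `Ψ_i` at level `Γ` -/
  Theta : ∀ {L : CMField} {ι₁ : L →+* ℂ} (V : HermSpace3 L ι₁), SeesawCtx L → Fin 4 → ∀ Γ : Level V,
    Set (U.CohC (U.pms L ι₁ V Γ) 1)

attribute [instance] LatticeModelThetaData.instT12₁ LatticeModelThetaData.instT12₂ LatticeModelThetaData.instT12₃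
  LatticeModelThetaData.instT12₄ LatticeModelThetaData.instT12₅ LatticeModelThetaData.instT34₁
  LatticeModelThetaData.instT34₂ LatticeModelThetaData.instT34₃ LatticeModelThetaData.instT34₄
  LatticeModelThetaData.instT34₅ LatticeModelThetaData.instν12 LatticeModelThetaData.instν34

namespace LatticeModelThetaData

variable {U} (D : U.LatticeModelThetaData)

/-- **The Weil-model theta data of a lattice-model one**: `quotU := (latU …).toQuotientModel`,
`quot := (lat …).toQuotientModel`.  Reducible, for instance search. -/
abbrev toWeilModelThetaData : U.WeilModelThetaData where
  quotU := fun L ι₁ V => (D.latU L ι₁ V).toQuotientModel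
  emb := D.emb
  cover := D.cover
  kappa := D.kappa
  frameSign := D.frameSign
  quot := fun V c => (D.lat V c).toQuotientModel
  wm := D.wm
  T12 := D.T12
  T34 := D.T34
  kt12 := D.kt12
  kt34 := D.kt34
  Theta := D.Theta

/-- (Ported verbatim from the HodgeCMPerL package; no docstring in the source.) -/
@[simp] theorem toWeilModelThetaData_quot {L : CMField} {ι₁ : L →+* ℂ} (V : HermSpace3 L ι₁) (c : SeesawCtx L) :
    D.toWeilModelThetaData.quot V c = (D.lat V c).toQuotientModel := rfl

/-- (Ported verbatim from the HodgeCMPerL package; no docstring in the source.) -/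
@[simp] theorem toWeilModelThetaData_quotU (L : CMField) (ι₁ : L →+* ℂ) (V : HermSpace3 L ι₁) :
    D.toWeilModelThetaData.quotU L ι₁ V = (D.latU L ι₁ V).toQuotientModel := rfl

/-- **The former hypothesis `hfc` HOLDS**: every theta-side model group `U(W)(𝔸)` of a lattice-model datum is
first countable (it is second countable). -/
theorem firstCountable {L : CMField} {ι₁ : L →+* ℂ} (V : HermSpace3 L ι₁) (c : SeesawCtx L) :
    FirstCountableTopology (D.toWeilModelThetaData.quot V c).G :=
  (D.lat V c).firstCountableTopology_toQuotientModel

/-- `AnalyticKM` over a lattice-model datum from the two reduced torus datums per context ALONE (no `hfc`). -/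
theorem analyticKM_of_quotientData
    (A12 : ∀ {L : CMField} {ι₁ : L →+* ℂ} (V : HermSpace3 L ι₁) (c : SeesawCtx L),
      QuotientTorusDatum (D.lat V c).toQuotientModel.ν
        (D.toWeilModelThetaData.toKernelModelThetaData.kcore V c).toRegCoreCarrier.toRepCoreCarrier
        (D.kt12 V c).toRegTorusCarrier.toRepTorusCarrier)
    (A34 : ∀ {L : CMField} {ι₁ : L →+* ℂ} (V : HermSpace3 L ι₁) (c : SeesawCtx L),
      QuotientTorusDatum (D.lat V c).toQuotientModel.ν
        (D.toWeilModelThetaData.toKernelModelThetaData.kcore V c).toRegCoreCarrier.toRepCoreCarrier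
        (D.kt34 V c).toRegTorusCarrier.toRepTorusCarrier) :
    D.toWeilModelThetaData.toKernelModelThetaData.AnalyticKM :=
  D.toWeilModelThetaData.analyticKM_of_quotientData D.firstCountable A12 A34

end LatticeModelThetaData

end Universe

/-! ## 3. END STATE over lattice models -/

namespace Assembly

open HodgeCM.PerL34 HodgeCM.PerL34.Annihilation
open HodgeCM.Prior.Perl34File HodgeCM.Prior.Perl34File.Perl34
open HodgeCM.Universe (LatticeModelThetaData WeilModelThetaData KernelModelThetaData ThetaModel)

variable (U : Universe)

/-- **Both realisation inputs of part (a) — `RealisationExistsPerL ∧ RealisationExistsFace` — over LATTICE models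
whose theta side is a WEIL THETA MODEL.**  Hypotheses: the model facts `M`; the DATA `D` (topological groups with
discrete cocompact subgroups, Weil theta models, tori, `emb`, `cover`, signs, theta one-forms); per context and torus
side the reduced annihilation datum (Prop 3.6 Step 2 data); the ten theta `Inputs`; Hodge–Riemann for `(2,0)`-forms.
NO structural hypothesis, NO named analytic hypothesis, NO measure-theoretic datum, NO `hfc`. -/
theorem realisationExists_ofLatticeModelData (M : U.ModelAxioms) (D : U.LatticeModelThetaData)
    (A12 : ∀ {L : CMField} {ι₁ : L →+* ℂ} (V : HermSpace3 L ι₁) (c : SeesawCtx L),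
      QuotientTorusDatum (D.lat V c).toQuotientModel.ν
        (D.toWeilModelThetaData.toKernelModelThetaData.kcore V c).toRegCoreCarrier.toRepCoreCarrier
        (D.kt12 V c).toRegTorusCarrier.toRepTorusCarrier)
    (A34 : ∀ {L : CMField} {ι₁ : L →+* ℂ} (V : HermSpace3 L ι₁) (c : SeesawCtx L),
      QuotientTorusDatum (D.lat V c).toQuotientModel.ν
        (D.toWeilModelThetaData.toKernelModelThetaData.kcore V c).toRegCoreCarrier.toRepCoreCarrier
        (D.kt34 V c).toRegTorusCarrier.toRepTorusCarrier)
    (A : (ThetaModel.ofRegCarrier D.toWeilModelThetaData.toKernelModelThetaData.toKernelThetaCarrier.toRegThetaCarrier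
      (D.analyticKM_of_quotientData A12 A34).toAnalytic).Inputs)
    (hHR : U.Fact_hodgeRiemann20) : U.RealisationExistsPerL ∧ U.RealisationExistsFace :=
  realisationExists_ofWeilModelData U M D.toWeilModelThetaData D.firstCountable A12 A34 A hHR

/-- **PerL over lattice models whose theta side is a Weil theta model** — HANDOVER #2's `perL_ofWeilModelData`
with `hfc` DISCHARGED. -/
theorem perL_ofLatticeModelData (M : U.ModelAxioms) (D : U.LatticeModelThetaData)
    (A12 : ∀ {L : CMField} {ι₁ : L →+* ℂ} (V : HermSpace3 L ι₁) (c : SeesawCtx L),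
      QuotientTorusDatum (D.lat V c).toQuotientModel.ν
        (D.toWeilModelThetaData.toKernelModelThetaData.kcore V c).toRegCoreCarrier.toRepCoreCarrier
        (D.kt12 V c).toRegTorusCarrier.toRepTorusCarrier)
    (A34 : ∀ {L : CMField} {ι₁ : L →+* ℂ} (V : HermSpace3 L ι₁) (c : SeesawCtx L),
      QuotientTorusDatum (D.lat V c).toQuotientModel.ν
        (D.toWeilModelThetaData.toKernelModelThetaData.kcore V c).toRegCoreCarrier.toRepCoreCarrier
        (D.kt34 V c).toRegTorusCarrier.toRepTorusCarrier)
    (A : (ThetaModel.ofRegCarrier D.toWeilModelThetaData.toKernelModelThetaData.toKernelThetaCarrier.toRegThetaCarrier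
      (D.analyticKM_of_quotientData A12 A34).toAnalytic).Inputs)
    (hHR : U.Fact_hodgeRiemann20) : U.PerL :=
  perL_ofWeilModelData U M D.toWeilModelThetaData D.firstCountable A12 A34 A hHR

/-- **COR-CM, END STATE over lattice models whose theta side is a Weil theta model** — HANDOVER #2's
`COR_CM_endState_ofWeilModelData` with `hfc` DISCHARGED.  Hypotheses: `M`, `h29`, `h30`, the QW8 facts, the DATA
`D`, the two reduced torus datums per context, the ten theta `Inputs`, Hodge–Riemann. -/
theorem COR_CM_endState_ofLatticeModelData (M : U.ModelAxioms) (h29 : U.Fact_weightSpan)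
    (h30 : U.Fact_weightHodge) (hE : U.Qw8ExtProd) (hD : U.Qw8DualPushPull) (hMi : U.Qw8Milne)
    (D : U.LatticeModelThetaData)
    (A12 : ∀ {L : CMField} {ι₁ : L →+* ℂ} (V : HermSpace3 L ι₁) (c : SeesawCtx L),
      QuotientTorusDatum (D.lat V c).toQuotientModel.ν
        (D.toWeilModelThetaData.toKernelModelThetaData.kcore V c).toRegCoreCarrier.toRepCoreCarrier
        (D.kt12 V c).toRegTorusCarrier.toRepTorusCarrier)
    (A34 : ∀ {L : CMField} {ι₁ : L →+* ℂ} (V : HermSpace3 L ι₁) (c : SeesawCtx L),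
      QuotientTorusDatum (D.lat V c).toQuotientModel.ν
        (D.toWeilModelThetaData.toKernelModelThetaData.kcore V c).toRegCoreCarrier.toRepCoreCarrier
        (D.kt34 V c).toRegTorusCarrier.toRepTorusCarrier)
    (A : (ThetaModel.ofRegCarrier D.toWeilModelThetaData.toKernelModelThetaData.toKernelThetaCarrier.toRegThetaCarrier
      (D.analyticKM_of_quotientData A12 A34).toAnalytic).Inputs)
    (hHR : U.Fact_hodgeRiemann20) : U.HC_CM :=
  COR_CM_endState_ofWeilModelData U M h29 h30 hE hD hMi D.toWeilModelThetaData D.firstCountable A12 A34 A hHR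

end Assembly

end HodgeCM

end
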